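import Mathlib
import HarnessLib
import Summits.KontsevichZagierPeriods.KontsevichZagierPeriods.Theses.LinRedNormalForm

/-!
# Line `janus-bands` — skeleton for crux `ArrangementNormalForm` (stmt-KontsevichZagierPeriods-3915)

Lead prover's skeleton of line `janus-bands` (planner
`planner-cruxplan-stmt-KontsevichZagierPeriods-391-janus-bands-0`, original skeleton sha
8f1e6dfa12e3, rebuilt from the registered stub signatures — the planner's file was never
published under `Cruxes/ArrangementNormalForm/Lines/` and the evidence store is not mounted in
the lead's jail), RESHAPED by the lead (2026-08-16): `stub_integrateOut` is split by the order
`n₂` of the distinguished pole (`stub_integrateOutLow`: `n₂ ≤ 1`, re-reading / unfolding only;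
`stub_integrateOutHigh`: `n₂ ≥ 2`, a genuine Newton–Leibniz integration), and `stub_endgame` is
split into `stub_unletter` (eliminate letter-free coordinates) and `stub_words` (lettered order
cells → words, purely geometric). Seven stubs, composition sorry-free.

## The class tower

* `wordGens` — the crux's generator set: hyperlogarithm WORD representations
  `[Δ_w, q · ∏ (tᵢ − aᵢ)⁻¹]`, `aᵢ, q ∈ ℚ`.
* `J b` — JANUS BAND representations with base dimension `b`: dimension `b + k`; the first `b`
  coordinates ("base", `Fin.castAdd k i`) range over an open rational polyhedral cell and carry a
  rational integrand `p(x) / ∏ Lⱼ(x)^{eⱼ}` with affine `Lⱼ`; the last `k` coordinates ("fibres",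
  `Fin.natAdd b i`) each carry at most one simple letter `1/(tᵢ − cᵢ(x))`, `cᵢ` affine in the
  base, and range in an open interval whose ends are either another fibre coordinate or an affine
  function of the base; the domain is bounded.
* `G b σ` (`σ = 1, 2`) — the same with base dimension `b + 1` and the LAST base coordinate `y`
  (`Fin.last b`) singled out: the rational part depends on `y` only through ONE factor
  `(y − ℓ₁(x))^{n₁}` or `(y − ℓ₂(x))^{−n₂}` (`n₁ = 0 ∨ n₂ = 0`); for `σ = 2` moreover no fibre
  letter depends on `y` and every affine fibre bound is `y`-free or `y` itself.
  `G₂lo b` / `G₂hi b` are `G b 2` with `n₂ ≤ 1` / `2 ≤ n₂`.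
* `Jw` — LETTERED ORDER CELLS: dimension `k`, every coordinate carries a constant letter, bounds
  are constants or other coordinates, bounded domain, integrand `q · ∏ 1/(zᵢ − aᵢ)`.

## The chain (one round per base variable; induction on `b`)

`stub_compactify : crux input ↦ closure (J n)` · `stub_separate : J (b+1) ↦ closure (G b 1)` ·
`stub_rebase : G b 1 ↦ closure (G b 2)` (HARDEST, lead) · `stub_integrateOutLow : G₂lo b ↦ closure (J b)` ·
`stub_integrateOutHigh : G₂hi b ↦ closure (J b)` · `stub_unletter : J 0 ↦ closure Jw` ·
`stub_words : Jw ↦ closure wordGens`.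
-/

noncomputable section

open MeasureTheory Set

namespace Summit.KontsevichZagierPeriods.KontsevichZagierPeriods.Cruxes.ArrangementNormalForm.JanusBands

open Literature.NumberTheory.Transcendental

/-- The crux's generator set: hyperlogarithm word representations `[Δ_w, q·∏ (tᵢ − aᵢ)⁻¹]`. -/
def wordGens : Set KZ.FormalRep :=
  {y : KZ.FormalRep | ∃ (w : ℕ) (a : Fin w → ℚ) (q : ℚ) (s : KZ.IntegralRep w), s.domain = {t | (∀ i, 0 < t i) ∧ (∀ i, t i < 1) ∧ StrictAnti t} ∧ Set.EqOn s.integrand (fun t => (q : ℝ) * ∏ i, 1 / (t i - (a i : ℝ))) s.domain ∧ y = KZ.of s}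

/-- Janus band representations with base dimension `b` (module docstring). -/
def J : ℕ → Set KZ.FormalRep := fun b =>
  {w : KZ.FormalRep | ∃ (k m m' : ℕ) (s : KZ.IntegralRep (b + k)) (M : Fin m' → (Fin b → ℚ) × ℚ) (L : Fin m → (Fin b → ℚ) × ℚ) (e : Fin m → ℕ) (p : MvPolynomial (Fin b) ℚ) (a : Fin k → Option ((Fin b → ℚ) × ℚ)) (lo hi : Fin k → Fin k ⊕ ((Fin b → ℚ) × ℚ)), Bornology.IsBounded s.domain ∧ s.domain = {z | (∀ j, 0 < ∑ i, ((M j).1 i : ℝ) * z (Fin.castAdd k i) + ((M j).2 : ℝ)) ∧ ∀ i, Sum.elim (fun j => z (Fin.natAdd b j)) (fun c => ∑ i', (c.1 i' : ℝ) * z (Fin.castAdd k i') + (c.2 : ℝ)) (lo i) < z (Fin.natAdd b i) ∧ z (Fin.natAdd b i) < Sum.elim (fun j => z (Fin.natAdd b j)) (fun c => ∑ i', (c.1 i' : ℝ) * z (Fin.castAdd k i') + (c.2 : ℝ)) (hi i)} ∧ EqOn s.integrand (fun z => MvPolynomial.aeval (fun i => z (Fin.castAdd k i)) p / (∏ j,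 (∑ i, ((L j).1 i : ℝ) * z (Fin.castAdd k i) + ((L j).2 : ℝ)) ^ e j) * ∏ i, (a i).elim 1 (fun c => 1 / (z (Fin.natAdd b i) - (∑ i', (c.1 i' : ℝ) * z (Fin.castAdd k i') + (c.2 : ℝ))))) s.domain ∧ w = KZ.of s}

/-- Separated (`σ = 1`) / rebased (`σ = 2`) Janus band representations, base dimension `b + 1`,
last base coordinate singled out (module docstring). -/
def G : ℕ → ℕ → Set KZ.FormalRep := fun b σ =>
  {w : KZ.FormalRep | ∃ (k m m' n₁ n₂ : ℕ) (s : KZ.IntegralRep (b + 1 + k)) (M : Fin m' → (Fin (b + 1) → ℚ) × ℚ) (L : Fin m → (Fin b → ℚ) × ℚ) (e : Fin m → ℕ) (p : MvPolynomial (Fin b) ℚ) (ℓ₁ ℓ₂ : (Fin b → ℚ) × ℚ) (a : Fin k → Option ((Fin (b + 1) → ℚ) × ℚ)) (lo hi : Fin k → Fin k ⊕ ((Fin (b + 1) → ℚ) × ℚ)), (n₁ = 0 ∨ n₂ = 0) ∧ (σ = 2 → (∀ i c, a i = some c → c.1 (Fin.last b) = 0) ∧ (∀ i c, (lo i = Sum.inr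 c ∨ hi i = Sum.inr c) → (c.1 (Fin.last b) = 0 ∨ c = (Pi.single (Fin.last b) 1, 0)))) ∧ Bornology.IsBounded s.domain ∧ s.domain = {z | (∀ j, 0 < ∑ i, ((M j).1 i : ℝ) * z (Fin.castAdd k i) + ((M j).2 : ℝ)) ∧ ∀ i, Sum.elim (fun j => z (Fin.natAdd (b + 1) j)) (fun c => ∑ i', (c.1 i' : ℝ) * z (Fin.castAdd k i') + (c.2 : ℝ)) (lo i) < z (Fin.natAdd (b + 1) i) ∧ z (Fin.natAdd (b + 1) i) < Sum.elim (fun j => z (Fin.natAdd (b + 1) j)) (fun c => ∑ i', (c.1 i' : ℝ) * z (Fin.castAdd k i') + (c.2 : ℝ)) (hi i)} ∧ EqOn s.integrand (fun z => MvPolynomial.aeval (fun i => z (Fin.castAdd k (Fin.castSucc i))) p / (∏ j, (∑ i, ((L j).1 i : ℝ) * z (Fin.castAdd k (Fin.castSucc i)) + ((L j).2 : ℝ)) ^ e j) * ((z (Fin.castAdd k (Fin.last b)) - (∑ i, (ℓ₁.1 i : ℝ) * z (Fin.castAdd k (Fin.castSucc i)) + (ℓ₁.2 : ℝ))) ^ n₁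 / (z (Fin.castAdd k (Fin.last b)) - (∑ i, (ℓ₂.1 i : ℝ) * z (Fin.castAdd k (Fin.castSucc i)) + (ℓ₂.2 : ℝ))) ^ n₂) * ∏ i, (a i).elim 1 (fun c => 1 / (z (Fin.natAdd (b + 1) i) - (∑ i', (c.1 i' : ℝ) * z (Fin.castAdd k i') + (c.2 : ℝ))))) s.domain ∧ w = KZ.of s}

/-- `G b 2` with a distinguished pole of order `n₂ ≤ 1`. -/
def G₂lo : ℕ → Set KZ.FormalRep := fun b =>
  {w : KZ.FormalRep | ∃ (k m m' n₁ n₂ : ℕ) (s : KZ.IntegralRep (b + 1 + k)) (M : Fin m' → (Fin (b + 1) → ℚ) × ℚ) (L : Fin m → (Fin b → ℚ) × ℚ) (e : Fin m → ℕ) (p : MvPolynomial (Fin b) ℚ) (ℓ₁ ℓ₂ : (Fin b → ℚ) × ℚ) (a : Fin k → Option ((Fin (b + 1) → ℚ) × ℚ)) (lo hi : Fin k → Fin k ⊕ ((Fin (b + 1) → ℚ) × ℚ)), (n₁ = 0 ∨ n₂ = 0) ∧ n₂ ≤ 1 ∧ (∀ i c, a i = some c → c.1 (Fin.last b) = 0)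 ∧ (∀ i c, (lo i = Sum.inr c ∨ hi i = Sum.inr c) → (c.1 (Fin.last b) = 0 ∨ c = (Pi.single (Fin.last b) 1, 0))) ∧ Bornology.IsBounded s.domain ∧ s.domain = {z | (∀ j, 0 < ∑ i, ((M j).1 i : ℝ) * z (Fin.castAdd k i) + ((M j).2 : ℝ)) ∧ ∀ i, Sum.elim (fun j => z (Fin.natAdd (b + 1) j)) (fun c => ∑ i', (c.1 i' : ℝ) * z (Fin.castAdd k i') + (c.2 : ℝ)) (lo i) < z (Fin.natAdd (b + 1) i) ∧ z (Fin.natAdd (b + 1) i) < Sum.elim (fun j => z (Fin.natAdd (b + 1) j)) (fun c => ∑ i', (c.1 i' : ℝ) * z (Fin.castAdd k i') + (c.2 : ℝ)) (hi i)} ∧ EqOn s.integrand (fun z => MvPolynomial.aeval (fun i => z (Fin.castAdd k (Fin.castSucc i))) p / (∏ j, (∑ i, ((L j).1 i : ℝ) * z (Fin.castAdd k (Fin.castSucc i)) + ((L j).2 : ℝ)) ^ e j) * ((z (Fin.castAdd k (Fin.last b)) - (∑ i, (ℓ₁.1 i : ℝ) * z (Fin.castAdd k (Fin.castSucc i)) +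 (ℓ₁.2 : ℝ))) ^ n₁ / (z (Fin.castAdd k (Fin.last b)) - (∑ i, (ℓ₂.1 i : ℝ) * z (Fin.castAdd k (Fin.castSucc i)) + (ℓ₂.2 : ℝ))) ^ n₂) * ∏ i, (a i).elim 1 (fun c => 1 / (z (Fin.natAdd (b + 1) i) - (∑ i', (c.1 i' : ℝ) * z (Fin.castAdd k i') + (c.2 : ℝ))))) s.domain ∧ w = KZ.of s}

/-- `G b 2` with a distinguished pole of order `n₂ ≥ 2`. -/
def G₂hi : ℕ → Set KZ.FormalRep := fun b =>
  {w : KZ.FormalRep | ∃ (k m m' n₁ n₂ : ℕ) (s : KZ.IntegralRep (b + 1 + k)) (M : Fin m' → (Fin (b + 1) → ℚ) × ℚ) (L : Fin m → (Fin b → ℚ) × ℚ) (e : Fin m → ℕ) (p : MvPolynomial (Fin b) ℚ) (ℓ₁ ℓ₂ : (Fin b → ℚ) × ℚ) (a : Fin k → Option ((Fin (b + 1) → ℚ) × ℚ)) (lo hi : Fin k → Fin k ⊕ ((Fin (b + 1) → ℚ) × ℚ)), (n₁ = 0 ∨ n₂ = 0) ∧ 2 ≤ n₂ ∧ (∀ i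 c, a i = some c → c.1 (Fin.last b) = 0) ∧ (∀ i c, (lo i = Sum.inr c ∨ hi i = Sum.inr c) → (c.1 (Fin.last b) = 0 ∨ c = (Pi.single (Fin.last b) 1, 0))) ∧ Bornology.IsBounded s.domain ∧ s.domain = {z | (∀ j, 0 < ∑ i, ((M j).1 i : ℝ) * z (Fin.castAdd k i) + ((M j).2 : ℝ)) ∧ ∀ i, Sum.elim (fun j => z (Fin.natAdd (b + 1) j)) (fun c => ∑ i', (c.1 i' : ℝ) * z (Fin.castAdd k i') + (c.2 : ℝ)) (lo i) < z (Fin.natAdd (b + 1) i) ∧ z (Fin.natAdd (b + 1) i) < Sum.elim (fun j => z (Fin.natAdd (b + 1) j)) (fun c => ∑ i', (c.1 i' : ℝ) * z (Fin.castAdd k i') + (c.2 : ℝ)) (hi i)} ∧ EqOn s.integrand (fun z => MvPolynomial.aeval (fun i => z (Fin.castAdd k (Fin.castSucc i))) p / (∏ j, (∑ i, ((L j).1 i : ℝ) * z (Fin.castAdd k (Fin.castSucc i)) + ((L j).2 : ℝ)) ^ e j) * ((z (Fin.castAdd k (Fin.last b)) - (∑ i, (ℓ₁.1 i : ℝ)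 * z (Fin.castAdd k (Fin.castSucc i)) + (ℓ₁.2 : ℝ))) ^ n₁ / (z (Fin.castAdd k (Fin.last b)) - (∑ i, (ℓ₂.1 i : ℝ) * z (Fin.castAdd k (Fin.castSucc i)) + (ℓ₂.2 : ℝ))) ^ n₂) * ∏ i, (a i).elim 1 (fun c => 1 / (z (Fin.natAdd (b + 1) i) - (∑ i', (c.1 i' : ℝ) * z (Fin.castAdd k i') + (c.2 : ℝ))))) s.domain ∧ w = KZ.of s}

/-- Lettered order cells (module docstring). -/
def Jw : Set KZ.FormalRep :=
  {w : KZ.FormalRep | ∃ (k : ℕ) (s : KZ.IntegralRep k) (q : ℚ) (a : Fin k → ℚ) (lo hi : Fin k → Fin k ⊕ ℚ), Bornology.IsBounded s.domain ∧ s.domain = {z | ∀ i, Sum.elim z (fun c => (c : ℝ)) (lo i) < z i ∧ z i < Sum.elim z (fun c => (c : ℝ)) (hi i)} ∧ EqOn s.integrand (fun z => (q : ℝ) * ∏ i, 1 / (z i - (a i : ℝ))) s.domain ∧ w = KZ.of s}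

/-! ## The seven registered stubs -/

/-- **stub_compactify** (M–L). Every crux input `[cell, p/∏Lⱼ^{eⱼ}]` (cell possibly unbounded)
is congruent modulo `KZ.relations` to a `ℤ`-combination of elements of `J n` (bounded cells, no
fibre variables, `k = 0`): cut the cell by the coordinate hyperplanes into `2ⁿ` pieces, one per
open orthant (rule 1a, `KZ.of_sub_sum_of_mem_relations`), and compactify each piece by the
projective map `Φ(x) = x / (1 + ε·x)` (rule 2), `ε` the sign vector of the orthant: on the piece
`1 + ε·x > 1`, `Φ` is injective with inverse `y ↦ y/(1 − ε·y)`, `|det DΦ(x)| = (1 + ε·x)^{−(n+1)}`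
(matrix determinant lemma), the image is the bounded open polyhedral cell
`{ε·y < 1, εᵢyᵢ > 0, Mⱼ·y + mⱼ(1 − ε·y) > 0}`, and the new integrand is again
`p̃(y)/∏ L̃ⱼ(y)^{eⱼ}` with `L̃ⱼ(y) = Lⱼ-linear(y) + lⱼ(1 − ε·y)` and `p̃` the `(1 − ε·y)`-homogenisation
of `p` times a power of `(1 − ε·y)` (a negative power joins the denominator list). -/
theorem stub_compactify (J : ℕ → Set KZ.FormalRep) (hJ : ∀ b, J b = {w : KZ.FormalRep | ∃ (k m m' : ℕ) (s : KZ.IntegralRep (b + k)) (M : Fin m' → (Fin b → ℚ) × ℚ) (L : Fin m → (Fin b → ℚ) × ℚ) (e : Fin m → ℕ) (p : MvPolynomial (Fin b) ℚ) (a : Fin k → Option ((Fin b → ℚ) × ℚ)) (lo hi : Fin k → Fin k ⊕ ((Fin b → ℚ) × ℚ)), Bornology.IsBounded s.domain ∧ s.domain = {z | (∀ j, 0 < ∑ i, ((M j).1 i : ℝ) * z (Fin.castAdd k i) + ((M j).2 : ℝ)) ∧ ∀ i, Sum.elim (fun j => z (Fin.natAdd b j)) (fun c => ∑ i', (c.1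 i' : ℝ) * z (Fin.castAdd k i') + (c.2 : ℝ)) (lo i) < z (Fin.natAdd b i) ∧ z (Fin.natAdd b i) < Sum.elim (fun j => z (Fin.natAdd b j)) (fun c => ∑ i', (c.1 i' : ℝ) * z (Fin.castAdd k i') + (c.2 : ℝ)) (hi i)} ∧ EqOn s.integrand (fun z => MvPolynomial.aeval (fun i => z (Fin.castAdd k i)) p / (∏ j, (∑ i, ((L j).1 i : ℝ) * z (Fin.castAdd k i) + ((L j).2 : ℝ)) ^ e j) * ∏ i, (a i).elim 1 (fun c => 1 / (z (Fin.natAdd b i) - (∑ i', (c.1 i' : ℝ) * z (Fin.castAdd k i') + (c.2 : ℝ))))) s.domain ∧ w = KZ.of s}) (n m m' : ℕ) (r : KZ.IntegralRep n) (M : Fin m' → (Fin n → ℚ) × ℚ) (L : Fin m → (Fin n → ℚ) × ℚ) (e : Fin m → ℕ) (p : MvPolynomial (Fin n) ℚ) (hdom : r.domain = {x | ∀ j, 0 < ∑ i, ((M j).1 i : ℝ) * x i + ((M j).2 : ℝ)}) (hint : EqOn r.integrand (fun x => MvPolynomial.aeval x p / ∏ j, (∑ i, ((L j).1 i : ℝ)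 * x i + ((L j).2 : ℝ)) ^ e j) r.domain) : ∃ c ∈ AddSubgroup.closure (J n), KZ.of r - c ∈ KZ.relations := by
  sorry

/-- **stub_separate** (L+). Partial fractions in the last base coordinate `y`: every element of
`J (b+1)` is congruent to a `ℤ`-combination of elements of `G b 1`. Rule 1b is legal only with
termwise absolutely convergent pieces: WALLS (hyperplanes of the base where two `y`-letters of the
rational part collide) make the naive expansion diverge; they must be avoided by the choice of
the eliminated direction / dissection (shadow-free pieces, domination) or compensated. -/
theorem stub_separate (J : ℕ → Set KZ.FormalRep) (G : ℕ → ℕ → Set KZ.FormalRep) (hJ : ∀ b, J b = {w : KZ.FormalRep | ∃ (k m m' : ℕ) (s : KZ.IntegralRep (b + k)) (M : Fin m' → (Fin b → ℚ) × ℚ) (L : Fin m → (Fin b → ℚ) × ℚ) (e : Fin m → ℕ) (p : MvPolynomial (Fin b) ℚ) (a : Fin k → Option ((Fin b → ℚ) × ℚ)) (lo hi : Fin k → Fin k ⊕ ((Fin b → ℚ) × ℚ)), Bornology.IsBounded s.domain ∧ s.domain = {z | (∀ j, 0 < ∑ i, ((M j).1 i : ℝ) * z (Fin.castAdd k i) +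 ((M j).2 : ℝ)) ∧ ∀ i, Sum.elim (fun j => z (Fin.natAdd b j)) (fun c => ∑ i', (c.1 i' : ℝ) * z (Fin.castAdd k i') + (c.2 : ℝ)) (lo i) < z (Fin.natAdd b i) ∧ z (Fin.natAdd b i) < Sum.elim (fun j => z (Fin.natAdd b j)) (fun c => ∑ i', (c.1 i' : ℝ) * z (Fin.castAdd k i') + (c.2 : ℝ)) (hi i)} ∧ EqOn s.integrand (fun z => MvPolynomial.aeval (fun i => z (Fin.castAdd k i)) p / (∏ j, (∑ i, ((L j).1 i : ℝ) * z (Fin.castAdd k i) + ((L j).2 : ℝ)) ^ e j) * ∏ i, (a i).elim 1 (fun c => 1 / (z (Fin.natAdd b i) - (∑ i', (c.1 i' : ℝ) * z (Fin.castAdd k i') + (c.2 : ℝ))))) s.domain ∧ w = KZ.of s}) (hG : ∀ b σ, G b σ = {w : KZ.FormalRep | ∃ (k m m' n₁ n₂ : ℕ) (s : KZ.IntegralRep (b + 1 + k)) (M : Fin m' → (Fin (b + 1) → ℚ) × ℚ) (L : Fin m → (Fin b → ℚ) × ℚ) (e : Fin m → ℕ) (p : MvPolynomial (Fin b) ℚ)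 (ℓ₁ ℓ₂ : (Fin b → ℚ) × ℚ) (a : Fin k → Option ((Fin (b + 1) → ℚ) × ℚ)) (lo hi : Fin k → Fin k ⊕ ((Fin (b + 1) → ℚ) × ℚ)), (n₁ = 0 ∨ n₂ = 0) ∧ (σ = 2 → (∀ i c, a i = some c → c.1 (Fin.last b) = 0) ∧ (∀ i c, (lo i = Sum.inr c ∨ hi i = Sum.inr c) → (c.1 (Fin.last b) = 0 ∨ c = (Pi.single (Fin.last b) 1, 0)))) ∧ Bornology.IsBounded s.domain ∧ s.domain = {z | (∀ j, 0 < ∑ i, ((M j).1 i : ℝ) * z (Fin.castAdd k i) + ((M j).2 : ℝ)) ∧ ∀ i, Sum.elim (fun j => z (Fin.natAdd (b + 1) j)) (fun c => ∑ i', (c.1 i' : ℝ) * z (Fin.castAdd k i') + (c.2 : ℝ)) (lo i) < z (Fin.natAdd (b + 1) i) ∧ z (Fin.natAdd (b + 1) i) < Sum.elim (fun j => z (Fin.natAdd (b + 1) j)) (fun c => ∑ i', (c.1 i' : ℝ) * z (Fin.castAdd k i') + (c.2 : ℝ)) (hi i)} ∧ EqOn s.integrand (fun z => MvPolynomial.aeval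 (fun i => z (Fin.castAdd k (Fin.castSucc i))) p / (∏ j, (∑ i, ((L j).1 i : ℝ) * z (Fin.castAdd k (Fin.castSucc i)) + ((L j).2 : ℝ)) ^ e j) * ((z (Fin.castAdd k (Fin.last b)) - (∑ i, (ℓ₁.1 i : ℝ) * z (Fin.castAdd k (Fin.castSucc i)) + (ℓ₁.2 : ℝ))) ^ n₁ / (z (Fin.castAdd k (Fin.last b)) - (∑ i, (ℓ₂.1 i : ℝ) * z (Fin.castAdd k (Fin.castSucc i)) + (ℓ₂.2 : ℝ))) ^ n₂) * ∏ i, (a i).elim 1 (fun c => 1 / (z (Fin.natAdd (b + 1) i) - (∑ i', (c.1 i' : ℝ) * z (Fin.castAdd k i') + (c.2 : ℝ))))) s.domain ∧ w = KZ.of s}) (b : ℕ) : ∀ x ∈ J (b + 1), ∃ c ∈ AddSubgroup.closure (G b 1), x - c ∈ KZ.relations := by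
  sorry

/-- **stub_rebase** (L+, HARDEST — held by the lead). Janus bands: every element of `G b 1` is
congruent to a `ℤ`-combination of elements of `G b 2` (no fibre letter depends on `y`; every
affine fibre bound is `y`-free or `y` itself): shear fibres so letters become `y`-free (rule 2),
split bands at the pinch value (rule 1a), rescale the base coordinate (rule 2). -/
theorem stub_rebase (G : ℕ → ℕ → Set KZ.FormalRep) (hG : ∀ b σ, G b σ = {w : KZ.FormalRep | ∃ (k m m' n₁ n₂ : ℕ) (s : KZ.IntegralRep (b + 1 + k)) (M : Fin m' → (Fin (b + 1) → ℚ) × ℚ) (L : Fin m → (Fin b → ℚ) × ℚ) (e : Fin m → ℕ) (p : MvPolynomial (Fin b) ℚ) (ℓ₁ ℓ₂ : (Fin b → ℚ) × ℚ) (a : Fin k → Option ((Fin (b + 1) → ℚ) × ℚ)) (lo hi : Fin k → Fin k ⊕ ((Fin (b + 1) → ℚ) × ℚ)), (n₁ = 0 ∨ n₂ = 0) ∧ (σ = 2 → (∀ i c, a i = some c → c.1 (Fin.last b) = 0) ∧ (∀ i c, (lo i = Sum.inr c ∨ hi i = Sum.inr c) → (c.1 (Fin.last b) = 0 ∨ c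 = (Pi.single (Fin.last b) 1, 0)))) ∧ Bornology.IsBounded s.domain ∧ s.domain = {z | (∀ j, 0 < ∑ i, ((M j).1 i : ℝ) * z (Fin.castAdd k i) + ((M j).2 : ℝ)) ∧ ∀ i, Sum.elim (fun j => z (Fin.natAdd (b + 1) j)) (fun c => ∑ i', (c.1 i' : ℝ) * z (Fin.castAdd k i') + (c.2 : ℝ)) (lo i) < z (Fin.natAdd (b + 1) i) ∧ z (Fin.natAdd (b + 1) i) < Sum.elim (fun j => z (Fin.natAdd (b + 1) j)) (fun c => ∑ i', (c.1 i' : ℝ) * z (Fin.castAdd k i') + (c.2 : ℝ)) (hi i)} ∧ EqOn s.integrand (fun z => MvPolynomial.aeval (fun i => z (Fin.castAdd k (Fin.castSucc i))) p / (∏ j, (∑ i, ((L j).1 i : ℝ) * z (Fin.castAdd k (Fin.castSucc i)) + ((L j).2 : ℝ)) ^ e j) * ((z (Fin.castAdd k (Fin.last b)) - (∑ i, (ℓ₁.1 i : ℝ) * z (Fin.castAdd k (Fin.castSucc i)) + (ℓ₁.2 : ℝ))) ^ n₁ / (z (Fin.castAdd k (Fin.last b)) - (∑ i, (ℓ₂.1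 i : ℝ) * z (Fin.castAdd k (Fin.castSucc i)) + (ℓ₂.2 : ℝ))) ^ n₂) * ∏ i, (a i).elim 1 (fun c => 1 / (z (Fin.natAdd (b + 1) i) - (∑ i', (c.1 i' : ℝ) * z (Fin.castAdd k i') + (c.2 : ℝ))))) s.domain ∧ w = KZ.of s}) (b : ℕ) : ∀ x ∈ G b 1, ∃ c ∈ AddSubgroup.closure (G b 2), x - c ∈ KZ.relations := by
  sorry

/-- **stub_integrateOutLow** (M–L). `n₂ ≤ 1`: after a cylindrical dissection of the base cell
over its first `b` coordinates (rule 1a) the coordinate `y` has one affine lower and one affine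
upper bound; a factor `(y − ℓ₁)^{n₁}` (`n₁ ≥ 1`, then `n₂ = 0`) is unfolded into `n₁` letter-free
fibre coordinates (rule 3 read backwards with a polynomial primitive, after cutting the base at
`y = ℓ₁(x)`), and `y` is re-read as the FIRST fibre coordinate (same index `b`; letter `ℓ₂` if
`n₂ = 1`, none if `n₂ = 0`); a transport `IntegralRep (b+1+k) → IntegralRep (b+(k+1))` along
`Nat.succ_add`-type equalities identifies the generator. -/
theorem stub_integrateOutLow (J : ℕ → Set KZ.FormalRep) (G₂ : ℕ → Set KZ.FormalRep) (hJ : ∀ b, J b = {w : KZ.FormalRep | ∃ (k m m' : ℕ) (s : KZ.IntegralRep (b + k)) (M : Fin m' → (Fin b → ℚ) × ℚ) (L : Fin m → (Fin b → ℚ) × ℚ) (e : Fin m → ℕ) (p : MvPolynomial (Fin b) ℚ) (a : Fin k → Option ((Fin b → ℚ) × ℚ)) (lo hi : Fin k → Fin k ⊕ ((Fin b → ℚ) × ℚ)), Bornology.IsBounded s.domain ∧ s.domain = {z | (∀ j, 0 < ∑ i, ((M j).1 i : ℝ) * z (Fin.castAdd k i) + ((M j).2 : ℝ)) ∧ ∀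 i, Sum.elim (fun j => z (Fin.natAdd b j)) (fun c => ∑ i', (c.1 i' : ℝ) * z (Fin.castAdd k i') + (c.2 : ℝ)) (lo i) < z (Fin.natAdd b i) ∧ z (Fin.natAdd b i) < Sum.elim (fun j => z (Fin.natAdd b j)) (fun c => ∑ i', (c.1 i' : ℝ) * z (Fin.castAdd k i') + (c.2 : ℝ)) (hi i)} ∧ EqOn s.integrand (fun z => MvPolynomial.aeval (fun i => z (Fin.castAdd k i)) p / (∏ j, (∑ i, ((L j).1 i : ℝ) * z (Fin.castAdd k i) + ((L j).2 : ℝ)) ^ e j) * ∏ i, (a i).elim 1 (fun c => 1 / (z (Fin.natAdd b i) - (∑ i', (c.1 i' : ℝ) * z (Fin.castAdd k i') + (c.2 : ℝ))))) s.domain ∧ w = KZ.of s}) (hG₂ : ∀ b, G₂ b = {w : KZ.FormalRep | ∃ (k m m' n₁ n₂ : ℕ) (s : KZ.IntegralRep (b + 1 + k)) (M : Fin m' → (Fin (b + 1) → ℚ) × ℚ) (L : Fin m → (Fin b → ℚ) × ℚ) (e : Fin m → ℕ) (p : MvPolynomial (Fin b) ℚ) (ℓ₁ ℓ₂ : (Fin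 b → ℚ) × ℚ) (a : Fin k → Option ((Fin (b + 1) → ℚ) × ℚ)) (lo hi : Fin k → Fin k ⊕ ((Fin (b + 1) → ℚ) × ℚ)), (n₁ = 0 ∨ n₂ = 0) ∧ n₂ ≤ 1 ∧ (∀ i c, a i = some c → c.1 (Fin.last b) = 0) ∧ (∀ i c, (lo i = Sum.inr c ∨ hi i = Sum.inr c) → (c.1 (Fin.last b) = 0 ∨ c = (Pi.single (Fin.last b) 1, 0))) ∧ Bornology.IsBounded s.domain ∧ s.domain = {z | (∀ j, 0 < ∑ i, ((M j).1 i : ℝ) * z (Fin.castAdd k i) + ((M j).2 : ℝ)) ∧ ∀ i, Sum.elim (fun j => z (Fin.natAdd (b + 1) j)) (fun c => ∑ i', (c.1 i' : ℝ) * z (Fin.castAdd k i') + (c.2 : ℝ)) (lo i) < z (Fin.natAdd (b + 1) i) ∧ z (Fin.natAdd (b + 1) i) < Sum.elim (fun j => z (Fin.natAdd (b + 1) j)) (fun c => ∑ i', (c.1 i' : ℝ) * z (Fin.castAdd k i') + (c.2 : ℝ)) (hi i)} ∧ EqOn s.integrand (fun z => MvPolynomial.aeval (fun i => z (Fin.castAdd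 k (Fin.castSucc i))) p / (∏ j, (∑ i, ((L j).1 i : ℝ) * z (Fin.castAdd k (Fin.castSucc i)) + ((L j).2 : ℝ)) ^ e j) * ((z (Fin.castAdd k (Fin.last b)) - (∑ i, (ℓ₁.1 i : ℝ) * z (Fin.castAdd k (Fin.castSucc i)) + (ℓ₁.2 : ℝ))) ^ n₁ / (z (Fin.castAdd k (Fin.last b)) - (∑ i, (ℓ₂.1 i : ℝ) * z (Fin.castAdd k (Fin.castSucc i)) + (ℓ₂.2 : ℝ))) ^ n₂) * ∏ i, (a i).elim 1 (fun c => 1 / (z (Fin.natAdd (b + 1) i) - (∑ i', (c.1 i' : ℝ) * z (Fin.castAdd k i') + (c.2 : ℝ))))) s.domain ∧ w = KZ.of s}) (b : ℕ) : ∀ x ∈ G₂ b, ∃ c ∈ AddSubgroup.closure (J b), x - c ∈ KZ.relations := by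
  sorry

/-- **stub_integrateOutHigh** (L). `n₂ ≥ 2` (then `n₁ = 0`): integrate `y` out by rule 3 with
the rational primitive `(y − ℓ₂)^{1−n₂}/(1−n₂) · (rest)` (letters are `y`-free), after permuting
`y` to the last coordinate (rule 2) and dissecting so that `y` has a single active lower/upper
bound among {affine(x), fibres attached to `y`} (rule 1a); fibres that were attached to `y`
acquire the extra letter `ℓ₂(x)`, to be separated again with coefficients rational in `x`. -/
theorem stub_integrateOutHigh (J : ℕ → Set KZ.FormalRep) (G₂ : ℕ → Set KZ.FormalRep) (hJ : ∀ b, J b = {w : KZ.FormalRep | ∃ (k m m' : ℕ) (s : KZ.IntegralRep (b + k)) (M : Fin m' → (Fin b → ℚ) × ℚ) (L : Fin m → (Fin b → ℚ) × ℚ) (e : Fin m → ℕ) (p : MvPolynomial (Fin b) ℚ) (a : Fin k → Option ((Fin b → ℚ) × ℚ)) (lo hi : Fin k → Fin k ⊕ ((Fin b → ℚ) × ℚ)), Bornology.IsBounded s.domain ∧ s.domain = {z | (∀ j, 0 < ∑ i, ((M j).1 i : ℝ) * z (Fin.castAdd k i) + ((M j).2 : ℝ)) ∧ ∀ i, Sum.elim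 (fun j => z (Fin.natAdd b j)) (fun c => ∑ i', (c.1 i' : ℝ) * z (Fin.castAdd k i') + (c.2 : ℝ)) (lo i) < z (Fin.natAdd b i) ∧ z (Fin.natAdd b i) < Sum.elim (fun j => z (Fin.natAdd b j)) (fun c => ∑ i', (c.1 i' : ℝ) * z (Fin.castAdd k i') + (c.2 : ℝ)) (hi i)} ∧ EqOn s.integrand (fun z => MvPolynomial.aeval (fun i => z (Fin.castAdd k i)) p / (∏ j, (∑ i, ((L j).1 i : ℝ) * z (Fin.castAdd k i) + ((L j).2 : ℝ)) ^ e j) * ∏ i, (a i).elim 1 (fun c => 1 / (z (Fin.natAdd b i) - (∑ i', (c.1 i' : ℝ) * z (Fin.castAdd k i') + (c.2 : ℝ))))) s.domain ∧ w = KZ.of s}) (hG₂ : ∀ b, G₂ b = {w : KZ.FormalRep | ∃ (k m m' n₁ n₂ : ℕ) (s : KZ.IntegralRep (b + 1 + k)) (M : Fin m' → (Fin (b + 1) → ℚ) × ℚ) (L : Fin m → (Fin b → ℚ) × ℚ) (e : Fin m → ℕ) (p : MvPolynomial (Fin b) ℚ) (ℓ₁ ℓ₂ : (Fin b → ℚ)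 × ℚ) (a : Fin k → Option ((Fin (b + 1) → ℚ) × ℚ)) (lo hi : Fin k → Fin k ⊕ ((Fin (b + 1) → ℚ) × ℚ)), (n₁ = 0 ∨ n₂ = 0) ∧ 2 ≤ n₂ ∧ (∀ i c, a i = some c → c.1 (Fin.last b) = 0) ∧ (∀ i c, (lo i = Sum.inr c ∨ hi i = Sum.inr c) → (c.1 (Fin.last b) = 0 ∨ c = (Pi.single (Fin.last b) 1, 0))) ∧ Bornology.IsBounded s.domain ∧ s.domain = {z | (∀ j, 0 < ∑ i, ((M j).1 i : ℝ) * z (Fin.castAdd k i) + ((M j).2 : ℝ)) ∧ ∀ i, Sum.elim (fun j => z (Fin.natAdd (b + 1) j)) (fun c => ∑ i', (c.1 i' : ℝ) * z (Fin.castAdd k i') + (c.2 : ℝ)) (lo i) < z (Fin.natAdd (b + 1) i) ∧ z (Fin.natAdd (b + 1) i) < Sum.elim (fun j => z (Fin.natAdd (b + 1) j)) (fun c => ∑ i', (c.1 i' : ℝ) * z (Fin.castAdd k i') + (c.2 : ℝ)) (hi i)} ∧ EqOn s.integrand (fun z => MvPolynomial.aeval (fun i => z (Fin.castAdd k (Fin.castSucc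 i))) p / (∏ j, (∑ i, ((L j).1 i : ℝ) * z (Fin.castAdd k (Fin.castSucc i)) + ((L j).2 : ℝ)) ^ e j) * ((z (Fin.castAdd k (Fin.last b)) - (∑ i, (ℓ₁.1 i : ℝ) * z (Fin.castAdd k (Fin.castSucc i)) + (ℓ₁.2 : ℝ))) ^ n₁ / (z (Fin.castAdd k (Fin.last b)) - (∑ i, (ℓ₂.1 i : ℝ) * z (Fin.castAdd k (Fin.castSucc i)) + (ℓ₂.2 : ℝ))) ^ n₂) * ∏ i, (a i).elim 1 (fun c => 1 / (z (Fin.natAdd (b + 1) i) - (∑ i', (c.1 i' : ℝ) * z (Fin.castAdd k i') + (c.2 : ℝ))))) s.domain ∧ w = KZ.of s}) (b : ℕ) : ∀ x ∈ G₂ b, ∃ c ∈ AddSubgroup.closure (J b), x - c ∈ KZ.relations := by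
  sorry

/-- **stub_unletter** (L). Base dimension `0`: eliminate the letter-free coordinates of an order
cell with constant letters (rule 3 with primitive `(u − c)·rest`, `c` chosen as the constant
bound of `u` when it has one so that no splitting is needed; otherwise split by rule 1b with
termwise convergent pieces), re-reduce `(t − c)/(t − a) = 1 + (a − c)… ` until every remaining
coordinate carries exactly one simple constant letter. -/
theorem stub_unletter (J : ℕ → Set KZ.FormalRep) (Jw : Set KZ.FormalRep) (hJ : ∀ b, J b = {w : KZ.FormalRep | ∃ (k m m' : ℕ) (s : KZ.IntegralRep (b + k)) (M : Fin m' → (Fin b → ℚ) × ℚ) (L : Fin m → (Fin b → ℚ) × ℚ) (e : Fin m → ℕ) (p : MvPolynomial (Fin b) ℚ) (a : Fin k → Option ((Fin b → ℚ) × ℚ)) (lo hi : Fin k → Fin k ⊕ ((Fin b → ℚ) × ℚ)), Bornology.IsBounded s.domain ∧ s.domain = {z | (∀ j, 0 < ∑ i, ((M j).1 i : ℝ) * z (Fin.castAdd k i) + ((M j).2 : ℝ)) ∧ ∀ i, Sum.elim (fun j => z (Fin.natAdd b j)) (fun c => ∑ i', (c.1 i' : ℝ) * z (Fin.castAdd k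 i') + (c.2 : ℝ)) (lo i) < z (Fin.natAdd b i) ∧ z (Fin.natAdd b i) < Sum.elim (fun j => z (Fin.natAdd b j)) (fun c => ∑ i', (c.1 i' : ℝ) * z (Fin.castAdd k i') + (c.2 : ℝ)) (hi i)} ∧ EqOn s.integrand (fun z => MvPolynomial.aeval (fun i => z (Fin.castAdd k i)) p / (∏ j, (∑ i, ((L j).1 i : ℝ) * z (Fin.castAdd k i) + ((L j).2 : ℝ)) ^ e j) * ∏ i, (a i).elim 1 (fun c => 1 / (z (Fin.natAdd b i) - (∑ i', (c.1 i' : ℝ) * z (Fin.castAdd k i') + (c.2 : ℝ))))) s.domain ∧ w = KZ.of s}) (hJw : Jw = {w : KZ.FormalRep | ∃ (k : ℕ) (s : KZ.IntegralRep k) (q : ℚ) (a : Fin k → ℚ) (lo hi : Fin k → Fin k ⊕ ℚ), Bornology.IsBounded s.domain ∧ s.domain = {z | ∀ i, Sum.elim z (fun c => (c : ℝ)) (lo i) < z i ∧ z i < Sum.elim z (fun c => (c : ℝ)) (hi i)} ∧ EqOn s.integrand (fun z => (q : ℝ) * ∏ i, 1 / (z i - (a i : ℝ))) s.domain ∧ w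 = KZ.of s}) : ∀ x ∈ J 0, ∃ c ∈ AddSubgroup.closure Jw, x - c ∈ KZ.relations := by
  sorry

/-- **stub_words** (M–L). Lettered order cells are `ℤ`-combinations of words: dissect into totally
ordered pieces relative to the finitely many constant bounds (rule 1a; ties are null), rescale
each block of coordinates lying between two consecutive constants affinely onto `(0,1)` (rule 2;
letters stay rational, constants are absorbed in `q`), shuffle the blocks (rule 1a) and permute
coordinates into decreasing order (rule 2, `KZ.of_sub_of_reindex_mem_permRel`). No integrand is
ever split, so every piece is a restriction or an affine image of a convergent representation. -/
theorem stub_words (Jw : Set KZ.FormalRep) (hJw : Jw = {w : KZ.FormalRep | ∃ (k : ℕ) (s : KZ.IntegralRep k) (q : ℚ) (a : Fin k → ℚ) (lo hi : Fin k → Fin k ⊕ ℚ), Bornology.IsBounded s.domain ∧ s.domain = {z | ∀ i, Sum.elim z (fun c => (c : ℝ)) (lo i) < z i ∧ z i < Sum.elim z (fun c => (c : ℝ)) (hi i)} ∧ EqOn s.integrand (fun z => (q : ℝ) * ∏ i, 1 / (z i - (a i : ℝ))) s.domain ∧ w = KZ.of s}) : ∀ x ∈ Jw, ∃ c ∈ AddSubgroup.closure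 {y : KZ.FormalRep | ∃ (w : ℕ) (a : Fin w → ℚ) (q : ℚ) (s : KZ.IntegralRep w), s.domain = {t | (∀ i, 0 < t i) ∧ (∀ i, t i < 1) ∧ StrictAnti t} ∧ Set.EqOn s.integrand (fun t => (q : ℝ) * ∏ i, 1 / (t i - (a i : ℝ))) s.domain ∧ y = KZ.of s}, x - c ∈ KZ.relations := by
  sorry

/-! ## Composition (sorry-free) -/

/-- Additive extension of a generator-wise congruence to the generated subgroup. -/
theorem closure_transfer {S T : Set KZ.FormalRep}
    (h : ∀ x ∈ S, ∃ c ∈ AddSubgroup.closure T, x - c ∈ KZ.relations) :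
    ∀ x ∈ AddSubgroup.closure S, ∃ c ∈ AddSubgroup.closure T, x - c ∈ KZ.relations := by
  intro x hx
  induction hx using AddSubgroup.closure_induction with
  | mem x hx => exact h x hx
  | zero => exact ⟨0, zero_mem _, by simp⟩
  | add x y _ _ ihx ihy =>
    obtain ⟨m₁, hm₁, h₁⟩ := ihx
    obtain ⟨m₂, hm₂, h₂⟩ := ihy
    refine ⟨m₁ + m₂, add_mem hm₁ hm₂, ?_⟩
    have key := add_mem h₁ h₂
    rwa [show x - m₁ + (y - m₂) = x + y - (m₁ + m₂) by abel] at key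
  | neg x _ ih =>
    obtain ⟨m, hm, h⟩ := ih
    refine ⟨-m, neg_mem hm, ?_⟩
    have key := neg_mem h
    rwa [show -(x - m) = -x - -m by abel] at key

/-- Transitivity of generator-wise congruences through an intermediate generating set. -/
theorem transfer_trans {S T U : Set KZ.FormalRep}
    (h₁ : ∀ x ∈ S, ∃ c ∈ AddSubgroup.closure T, x - c ∈ KZ.relations)
    (h₂ : ∀ x ∈ T, ∃ c ∈ AddSubgroup.closure U, x - c ∈ KZ.relations) :
    ∀ x ∈ S, ∃ c ∈ AddSubgroup.closure U, x - c ∈ KZ.relations := by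
  intro x hx
  obtain ⟨c, hc, hxc⟩ := h₁ x hx
  obtain ⟨d, hd, hcd⟩ := closure_transfer h₂ c hc
  refine ⟨d, hd, ?_⟩
  have key := add_mem hxc hcd
  rwa [sub_add_sub_cancel] at key

/-- `G b 2` is covered by its low-order and high-order parts. -/
theorem G_two_subset (b : ℕ) : G b 2 ⊆ G₂lo b ∪ G₂hi b := by
  rintro w ⟨k, m, m', n₁, n₂, s, M, L, e, p, ℓ₁, ℓ₂, a, lo, hi, h12, hσ, hbd, hdom, hint, hw⟩
  rcases Nat.lt_or_ge n₂ 2 with hn | hn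
  · exact Or.inl ⟨k, m, m', n₁, n₂, s, M, L, e, p, ℓ₁, ℓ₂, a, lo, hi, h12, Nat.lt_succ_iff.mp hn,
      (hσ rfl).1, (hσ rfl).2, hbd, hdom, hint, hw⟩
  · exact Or.inr ⟨k, m, m', n₁, n₂, s, M, L, e, p, ℓ₁, ℓ₂, a, lo, hi, h12, hn,
      (hσ rfl).1, (hσ rfl).2, hbd, hdom, hint, hw⟩

/-- `G b 2 ↦ closure (J b)`, from the two halves. -/
theorem integrateOut (b : ℕ) :
    ∀ x ∈ G b 2, ∃ c ∈ AddSubgroup.closure (J b), x - c ∈ KZ.relations := by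
  intro x hx
  rcases G_two_subset b hx with h | h
  · exact stub_integrateOutLow J G₂lo (fun _ => rfl) (fun _ => rfl) b x h
  · exact stub_integrateOutHigh J G₂hi (fun _ => rfl) (fun _ => rfl) b x h

/-- One elimination round: `J (b+1) ↦ closure (J b)` (separate, rebase, integrate out). -/
theorem round_step (b : ℕ) :
    ∀ x ∈ J (b + 1), ∃ c ∈ AddSubgroup.closure (J b), x - c ∈ KZ.relations :=
  transfer_trans (stub_separate J G (fun _ => rfl) (fun _ _ => rfl) b)
    (transfer_trans (stub_rebase G (fun _ _ => rfl) b) (integrateOut b))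

/-- The endgame `J 0 ↦ closure wordGens` (unletter, then words). -/
theorem endgame : ∀ x ∈ J 0, ∃ c ∈ AddSubgroup.closure wordGens, x - c ∈ KZ.relations :=
  transfer_trans (stub_unletter J Jw (fun _ => rfl) rfl) (stub_words Jw rfl)

/-- Descent to base dimension `0` and the endgame: `J b ↦ closure wordGens`, by induction on `b`. -/
theorem descend : ∀ b : ℕ, ∀ x ∈ J b, ∃ c ∈ AddSubgroup.closure wordGens, x - c ∈ KZ.relations
  | 0 => endgame
  | b + 1 => transfer_trans (round_step b) (descend b)

/-- **The crux, from the seven stubs.** `LinRedNormalForm.ArrangementNormalForm` BY NAME: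
compactify into `closure (J n)`, descend `J n ↦ closure wordGens`; `wordGens` is verbatim the
crux's generator set. -/
theorem ArrangementNormalForm_of :
    Summit.KontsevichZagierPeriods.KontsevichZagierPeriods.Theses.LinRedNormalForm.ArrangementNormalForm := by
  intro n m m' r M L e p hdom hint
  obtain ⟨c, hc, hrc⟩ := stub_compactify J (fun _ => rfl) n m m' r M L e p hdom hint
  obtain ⟨d, hd, hcd⟩ := closure_transfer (descend n) c hc
  refine ⟨d, hd, ?_⟩
  have key := add_mem hrc hcd
  rwa [sub_add_sub_cancel] at key

end Summit.KontsevichZagierPeriods.KontsevichZagierPeriods.Cruxes.ArrangementNormalForm.JanusBands
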